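import Literature.AlgebraicGeometry.Resolution.NormalSurfaceSingularLocus
import Literature.Barriers.ResolutionOfSingularities.DimensionFourFrontier
import HarnessLib

/-!
# Resolution and local uniformization of surfaces over EVERY field, from Cossart–Jannsen–Saito's
# Theorem 1.2 as printed (packaging of tree theorems; no new named fact)

Topic: `Literature/AlgebraicGeometry/Resolution`. PROVED glue, def-free. The tree holds

* the printed form of V. Cossart, U. Jannsen, S. Saito, *Desingularization: Invariants and Strategy*,
  LNM 2270 (2020), Thm. 1.2 as the named fact `CossartJannsenSaito2020General` (every reduced
  excellent Noetherian scheme of dimension `≤ 2` has a resolution which is an isomorphism over the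
  regular locus; `QuasiExcellentSchemes`),
* the field form `CossartJannsenSaito2020 ↔ ∀ k, ResolutionOverUpToDim k 2`
  (`cossartJannsenSaito2020_iff`, `ArithmeticalThreefolds`),
* the bridge `CossartJannsenSaito2020General.cossartJannsenSaito2020_holds_of :
  CossartJannsenSaito2020General → CossartJannsenSaito2020` (`NormalSurfaceSingularLocus`; it feeds
  `CossartJannsenSaito2020General.cossartJannsenSaito2020` with the THEOREM `Stacks07QW_field_holds`,
  finite type algebras over a field are excellent, `ExcellentRingsFieldProofs`),
* and `LocalUniformizationUpToDim.of_resolution` (weak resolution up to dimension `d` over `k` gives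
  local uniformization up to dimension `d` over `k`, valuative criterion;
  `Barriers/ResolutionOfSingularities/DimensionFourFrontier`).

This file only composes them, so that a consumer holding `CossartJannsenSaito2020General` (e.g. as a
member of a bundle of published surface facts) gets, BY ONE NAME and with no further hypothesis,
weak resolution and local uniformization of surfaces over an arbitrary field:

* `resolutionOverUpToDim_two (hCJS) k : ResolutionOverUpToDim k 2`;
* `localUniformizationUpToDim_two_of_cjsGeneral (hCJS) k : LocalUniformizationUpToDim k 2`.

Nothing here is a new statement of the literature; the cite tags point to the printed theorem whose
named fact is the only hypothesis. Consumers: the crux chain W4.4 of the summit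
`ResolutionOfSingularities` (its surface local-uniformization input over a non-closed residue field
`k(w)`); nothing here depends on that summit.

## References

* V. Cossart, U. Jannsen, S. Saito, *Desingularization: Invariants and Strategy — Application to
  Dimension 2*, Lecture Notes in Math. 2270, Springer (2020), Thm. 1.2. [CossartJannsenSaito2020]
* The Stacks Project, Tag 07QW (finite type algebras over a field are excellent). [StacksProject]
* S. D. Cutkosky, H. Mourtada, *Defect and local uniformization*, RACSAM 113 (2019), §1 (resolution
  implies local uniformization). [CutkoskyMourtada2019]
-/

noncomputable section

universe u

namespace Literature.AlgebraicGeometry.Resolution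

open Literature.Barriers.ResolutionOfSingularities

/-- **Weak resolution up to dimension `2` over an arbitrary field `k`** from CJS Thm. 1.2 as
printed: every reduced separated `k`-scheme of finite type of dimension `≤ 2` has a resolution of
singularities (`ResolutionOverUpToDim k 2`). [cite: CossartJannsenSaito2020, Thm. 1.2] -/
theorem resolutionOverUpToDim_two (hCJS : CossartJannsenSaito2020General.{u}) (k : Type u)
    [Field k] : ResolutionOverUpToDim k 2 :=
  cossartJannsenSaito2020_iff.mp hCJS.cossartJannsenSaito2020_holds_of k

/-- **Local uniformization up to dimension `2` over an arbitrary field `k`** from CJS Thm. 1.2 as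
printed: for every field `K ⊇ k`, valuation ring `O` of `K` and affine model `A ⊆ O` of `K` over `k`
of dimension `≤ 2`, some finitely generated `A ⊆ A' ⊆ O` is regular at the centre of `O`
(`LocalUniformizationUpToDim k 2`, via `LocalUniformizationUpToDim.of_resolution`).
[cite: CossartJannsenSaito2020, Thm. 1.2] -/
theorem localUniformizationUpToDim_two_of_cjsGeneral (hCJS : CossartJannsenSaito2020General.{u})
    (k : Type u) [Field k] : LocalUniformizationUpToDim k 2 :=
  LocalUniformizationUpToDim.of_resolution (resolutionOverUpToDim_two hCJS k)

end Literature.AlgebraicGeometry.Resolution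

end
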